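import Literature.NumberTheory.EllipticCurves.HeegnerNormPointExistenceProofs
import Literature.NumberTheory.EllipticCurves.HeegnerPointsOfConductorPrimeLevelProofs
import Literature.NumberTheory.EllipticCurves.HeegnerGeomTransversalProofs
import HarnessLib

/-!
# Heegner norm points and Heegner families of EVERY conductor — in particular of `p`-power
# conductor at a prime `p ∣ N` (no `gcd(c, N) = 1`, no Heegner hypothesis needed for existence)

Topic `NumberTheory/EllipticCurves` (complex multiplication on `X₀(N)`; the CM input of the
Heegner-module files `HeegnerModuleIndex.lean`: Howard 2004 §2.7/§3.3, Perrin-Riou 1987 §3.1–3.4,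
Gross 1991 §3). THEOREMS ONLY (no definition, no named fact; net Literature debt `0`).

The tree's named fact `exists_isHeegnerNormPoint N W K p` (`HeegnerModuleIndex.lean`), discharged in
`HeegnerNormPointExistenceProofs.lean` (`exists_isHeegnerNormPoint_holds`), carries Howard's standing
hypothesis `c.Coprime N` on the conductor, and so do its corollaries `nonempty_heegnerFamily_of`,
`exists_heegnerFamily_Dt_eq(_holds)` (`¬ p ∣ N`). The rationality theorem they rest on has since been
proved for EVERY conductor `n ≥ 1`:
`phi_heegnerPointOfConductor_mem_range_map_ringClassField_of_ne_zero`
(`HeegnerPointsOfConductorPrimeLevelProofs.lean`: Darmon 2004 Thm. 3.6 / Gross 1991 §3 at `τ = x(n)`,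
the order of `x(n)` is `𝒪_n` and that of `N x(n)` has conductor dividing `n`, so `Φ_N(x(n)) ∈ E(K[n])`;
proved through the tree's `Aut(ℂ)`-transport of level structures using only the primitivity of the
Heegner form). This file re-runs the assembly of `exists_isHeegnerNormPoint_holds` on that theorem:

* `exists_canonical_isHeegnerNormPoint_of_ne_zero` — for `W/ℚ` elliptic with a parametrisation datum
  `Dt` at level `N`, `K` imaginary quadratic, ANY orientation `β` (`4N ∣ β² − d_K`), embedding
  `jbar : K̄ → ℂ`, `ℤ_p`-extension `κ`, layer `n` and ANY conductor `c ≠ 0`: there are `x ∈ E(K̄)` with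
  `complexPoint x = y(c) = φ(x(c))` (the CANONICAL Heegner point of conductor `c`, root of the Heegner
  form `(c²(β² − d_K)/4, cβ, 1)` — `heegnerPointComplexOfConductor`), fixed by
  `Gal(K̄/K[c]) = ringClassSubgroup K c jbar`, and a finite transversal `R ⊆ Gal(K̄/K_n)` of
  `Gal(K̄/K_n K[c])` in `Gal(K̄/K_n)`; `z = ∑_{r ∈ R} r • x` `IsHeegnerNormPoint`;
* `exists_isHeegnerNormPoint_of_ne_zero` — the statement of `exists_isHeegnerNormPoint` with
  `c.Coprime N` replaced by `c ≠ 0` (and without the Heegner hypothesis, which the rationality does not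
  use);
* `exists_heegnerFamily_Dt_eq_of_dvd_sq_sub`, `nonempty_heegnerFamily_of_dvd_sq_sub` — Heegner
  FAMILIES along any `ℤ_p`-extension exist for EVERY prime `p`, dividing the level or not, tied to a
  given datum `Dt` and orientation `β` (`y` of conductor `1` over `K`, `z j` of conductor `p^{j+1}`
  over `K_j`);
* `exists_heegnerFamily_canonical` — the same family with its CM points exposed: every `z j` is the
  norm of a point `x_j` with `complexPoint x_j = y(p^{j+1})`.

WHY (cell `pub/bsd-wall`, route `CumulativeHeegnerLeopoldt`, crux K1 stmt-BirchSwinnertonDyer-24198 /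
A stmt-26896 at the ADDITIVE prime `p = 3`, `9 ∣ N`): the Heegner-module barrier lemmas
`…TraceZeroHeegnerModuleTorsion.heegnerModule_eq_bot_on_leopoldtCell_of_(eventually_)traceTorsion`
and every Heegner line at `p² ∣ N` take a `HeegnerFamily N W K κ jbar` as INPUT; before this file the
tree produced such families only for `p ∤ N` (lead memo BARRIER-MEMO-A26896 §3: "object deficit").
The OBJECTS now exist unconditionally; what print adds about them at `p² ∣ N` — Cornut–Vatsal 2007,
Lemma 4.9 (iii)/6.14 (torsion traces of GOOD CM points) and Thm. 1.10 (Mazur non-triviality) — is a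
separate named fact. Note (for that fact): at `p ∣ N` the canonical point `x(p^m)`, `m ≥ 1`, is GOOD
in Cornut–Vatsal's sense (Def. 1.6 / Def. 6.13, type I): its form has `A/N = p^{2m}(β² − d_K)/(4N)`
divisible by `p`, so the `N`-end lattice `ℤ + ℤ·N x(p^m)` (form `(A/N, B, NC)` of content divisible by
`p^{min(m, v_p N)}`) has CM order of conductor `p^{m − min(m, v_p N)} < p^m` at `p`.

HONEST FRAMING: classical CM theory assembled from proved tree theorems plus group theory; nothing
about `L`-functions, Selmer groups, trace relations or BSD is asserted.

## References

* [Howard2004HeegnerKolyvagin] B. Howard, *The Heegner point Kolyvagin system*, Compos. Math. 140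
  (2004), §2.7 and §3.3.
* [GrossLMS1991] B. H. Gross, *Kolyvagin's work on modular elliptic curves*, LMS LN 153 (1991), §3.
* [Darmon2004] H. Darmon, *Rational points on modular elliptic curves*, CBMS 101 (2004), Thm. 3.6.
* [CornutVatsal2007] C. Cornut, V. Vatsal, *Nontriviality of Rankin–Selberg L-functions and CM
  points*, LMS LN 320 (2007), §1.2 (CM points of conductor `Pⁿ` are defined over `K[Pⁿ]`, p. 160).

## Mathlib / tree search

Tree, by name: `phi_heegnerPointOfConductor_mem_range_map_ringClassField_of_ne_zero`,
`heegnerFormOfConductor_mem_heegnerForms`, `mem_range_of_mem_ringClassField`,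
`smul_eq_self_of_mem_ringClassSubgroup`, `finiteIndex_ringClassSubgroup`, `exists_finset_transversal'`,
`Affine.Point.congrEquiv_some`. `lean search 'exists_isHeegnerNormPoint_of_ne_zero|nonempty_heegnerFamily_of_dvd'`:
no prior statement.
-/

noncomputable section

open scoped Classical

universe u

namespace Literature.NumberTheory.EllipticCurves

open _root_.WeierstrassCurve
open Literature.NumberTheory.EllipticCurves.ModularForms

variable (N : ℕ) [NeZero N] (W : WeierstrassCurve ℚ) (K : Type u) [Field K] [NumberField K]
  {p : ℕ} [Fact p.Prime]

/-- **Canonical Heegner norm points of every conductor `c ≠ 0` exist** (Gross 1991 §3 / Howard 2004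
§2.7, §3.3, with Darmon 2004 Thm. 3.6 for ARBITRARY conductor): for `W/ℚ` elliptic with a
parametrisation datum `Dt` at level `N`, `K` imaginary quadratic, an orientation `β` (`4N ∣ β² − d_K`),
`jbar : K̄ → ℂ`, a `ℤ_p`-extension `κ`, a layer `n` and any `c ≠ 0`, there are a point `x ∈ E(K̄)` whose
complex point is the canonical Heegner point `y(c) = φ(x(c))` of conductor `c`
(`heegnerPointComplexOfConductor Dt d_K β c`), fixed by `Gal(K̄/K[c])`, and a finite transversal
`R ⊆ Gal(K̄/K_n)` of `Gal(K̄/K_n K[c])`; the norm `∑_{r ∈ R} r • x` `IsHeegnerNormPoint`. No coprimality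
of `c` and `N` and no Heegner hypothesis is needed. [cite: GrossLMS1991, §3 (p. 238)]
[cite: Darmon2004, Thm. 3.6 (PDF pp. 43–44)] [cite: Howard2004HeegnerKolyvagin, §2.7 and §3.3] -/
theorem exists_canonical_isHeegnerNormPoint_of_ne_zero [W.IsElliptic] (hK : IsImaginaryQuadratic K)
    (κ : ZpExtension K p) (Dt : ModularParametrizationData W N) {β : ℤ}
    (hβ : (4 * N : ℤ) ∣ β ^ 2 - NumberField.discr K) (jbar : AlgebraicClosure K →+* ℂ) (n : ℕ)
    {c : ℕ} (hc : c ≠ 0) :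
    ∃ (x : geomPoints (W.baseChange K)) (R : Finset (Field.absoluteGaloisGroup K)),
      complexPoint W jbar x = heegnerPointComplexOfConductor Dt (NumberField.discr K) β c ∧
      IsHeegnerGeomPoint N W K Dt β c jbar x ∧
      (∀ σ ∈ ringClassSubgroup K c jbar, σ • x = x) ∧
      (↑R ⊆ (κ.layerSubgroup n : Set (Field.absoluteGaloisGroup K))) ∧
      (∀ τ ∈ κ.layerSubgroup n, ∃! r, r ∈ R ∧ r⁻¹ * τ ∈ ringClassSubgroup K c jbar) ∧
      IsHeegnerNormPoint N W K κ Dt β jbar n c (∑ r ∈ R, r • x) := by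
  set Kbar := AlgebraicClosure K
  set ι : K →+* ℂ := jbar.comp (algebraMap K Kbar) with hι
  set G := ringClassSubgroup K c jbar with hG
  -- (1) rationality over the concrete ring class field `K[c] ⊂ ℂ`, for EVERY `c ≠ 0`
  obtain ⟨P, hP⟩ :=
    phi_heegnerPointOfConductor_mem_range_map_ringClassField_of_ne_zero N W K hK Dt β ι c hβ hc
  obtain ⟨hQ, hQβ⟩ := heegnerFormOfConductor_mem_heegnerForms (N := N) hK.discr_neg hβ hc
  set Q := heegnerFormOfConductor (NumberField.discr K) β c with hQ_def
  have hQ' : Q ∈ heegnerForms N (NumberField.discr K * (c : ℤ) ^ 2) := by rwa [mul_comm]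
  -- the curve equality behind `complexPoint`
  have hbc : (W.baseChange K).map (Algebra.ofId K Kbar : K →+* Kbar) = W.baseChange Kbar :=
    W.map_baseChange (Algebra.ofId K Kbar)
  -- (2) transfer to `E(K̄)`: a point `x` with `complexPoint x = φ(x(c))`, fixed by `G`
  have key : ∃ x : geomPoints (W.baseChange K),
      complexPoint W jbar x = heegnerPointComplexOfConductor Dt (NumberField.discr K) β c ∧
        ∀ σ ∈ G, σ • x = x := by
    rcases hPc : P with _ | ⟨u, v, huv⟩
    · refine ⟨0, ?_, fun σ _ ↦ smul_zero σ⟩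
      rw [map_zero]
      have h := hP
      rw [hPc] at h
      change WeierstrassCurve.Affine.Point.map _ 0 = _ at h
      rw [map_zero] at h
      exact h
    · -- coordinates as `jbar`-values
      obtain ⟨a, ha⟩ := mem_range_of_mem_ringClassField hK jbar hc u.2
      obtain ⟨b, hb⟩ := mem_range_of_mem_ringClassField hK jbar hc v.2
      have huvC : (W.baseChange ℂ).toAffine.Nonsingular (u : ℂ) (v : ℂ) :=
        (WeierstrassCurve.Affine.baseChange_nonsingular W
          (f := (ringClassField K ι c).subtype.toRatAlgHom) (ringClassField K ι c).subtype.injective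
          u v).mpr huv
      have hab : (W.baseChange Kbar).toAffine.Nonsingular a b := by
        rw [← WeierstrassCurve.Affine.baseChange_nonsingular W (f := jbar.toRatAlgHom) jbar.injective a b]
        simpa [ha, hb] using huvC
      have hab' : ((W.baseChange K).map (Algebra.ofId K Kbar : K →+* Kbar)).toAffine.Nonsingular a b := by
        rw [hbc]; exact hab
      refine ⟨.some a b hab', ?_, fun σ hσ ↦ ?_⟩
      · -- `complexPoint (a, b) = (jbar a, jbar b) = (u, v) = φ(x(c))`
        have h1 : complexPoint W jbar (.some a b hab') =
            WeierstrassCurve.Affine.Point.map jbar.toRatAlgHom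
              (WeierstrassCurve.Affine.Point.congrEquiv hbc (.some a b hab')) := rfl
        rw [h1, WeierstrassCurve.Affine.Point.congrEquiv_some hbc hab',
          WeierstrassCurve.Affine.Point.map_some]
        have h2 := hP
        rw [hPc, WeierstrassCurve.Affine.Point.map_some] at h2
        simp only [RingHom.toRatAlgHom_apply, Subfield.coe_subtype, ha, hb] at h2 ⊢
        rw [← h2]
      · -- `σ ∈ Gal(K̄/K[c])` fixes `a, b` (their `jbar`-images lie in `K[c]`)
        have hσa : σ • a = a :=
          smul_eq_self_of_mem_ringClassSubgroup hK jbar hc hσ (by rw [ha]; exact u.2)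
        have hσb : σ • b = b :=
          smul_eq_self_of_mem_ringClassSubgroup hK jbar hc hσ (by rw [hb]; exact v.2)
        rw [Field.absoluteGaloisGroup.smul_def] at hσa hσb
        change WeierstrassCurve.Affine.Point.map
          ((Field.absoluteGaloisGroup.toAlgEquiv K σ : Kbar ≃ₐ[K] Kbar) : Kbar →ₐ[K] Kbar)
          (.some a b hab') = .some a b hab'
        rw [WeierstrassCurve.Affine.Point.map_some]
        simp only [AlgEquiv.coe_toAlgHom, hσa, hσb]
  obtain ⟨x, hx, hfix⟩ := key
  have hgeom : IsHeegnerGeomPoint N W K Dt β c jbar x :=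
    ⟨Q, hQ', hQβ, by rw [hx]; rfl⟩
  -- (3) a finite transversal of `G ∩ Gal(K̄/K_n)` in `Gal(K̄/K_n)`
  haveI : G.FiniteIndex := finiteIndex_ringClassSubgroup K c jbar
  obtain ⟨R, hRsub, htrans⟩ := exists_finset_transversal' G (κ.layerSubgroup n)
  have hRsub' : (↑R : Set (Field.absoluteGaloisGroup K)) ⊆ κ.layerSubgroup n :=
    fun r hr ↦ hRsub r (Finset.mem_coe.mp hr)
  exact ⟨x, R, hx, hgeom, hfix, hRsub', htrans, x, R, hgeom, hfix, hRsub', htrans, rfl⟩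

/-- **Heegner norm points of every conductor `c ≠ 0` exist** — the statement of the named fact
`exists_isHeegnerNormPoint N W K p` with Howard's standing hypothesis `gcd(c, N) = 1` replaced by
`c ≠ 0` (and no Heegner hypothesis): for every `ℤ_p`-extension `κ`, datum `Dt`, orientation `β`,
embedding `jbar`, layer `n` and `c ≠ 0` some `z ∈ E(K̄)` `IsHeegnerNormPoint N W K κ Dt β jbar n c z`.
In particular Heegner norm points of `p`-power conductor exist at a prime `p ∣ N`
(Cornut–Vatsal 2007, p. 160: "a CM point of conductor `Pⁿ` is defined over `K[Pⁿ]`").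
[cite: Howard2004HeegnerKolyvagin, §2.7 and §3.3] [cite: GrossLMS1991, §3 (p. 238)]
[cite: Darmon2004, Thm. 3.6 (PDF pp. 43–44)] -/
theorem exists_isHeegnerNormPoint_of_ne_zero [W.IsElliptic] (hK : IsImaginaryQuadratic K)
    (κ : ZpExtension K p) (Dt : ModularParametrizationData W N) {β : ℤ}
    (hβ : (4 * N : ℤ) ∣ β ^ 2 - NumberField.discr K) (jbar : AlgebraicClosure K →+* ℂ) (n : ℕ)
    {c : ℕ} (hc : c ≠ 0) :
    ∃ z, IsHeegnerNormPoint N W K κ Dt β jbar n c z := by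
  obtain ⟨x, R, -, -, -, -, -, hz⟩ :=
    exists_canonical_isHeegnerNormPoint_of_ne_zero N W K hK κ Dt hβ jbar n hc
  exact ⟨_, hz⟩

variable {N W K}

/-- **Tied Heegner families exist along every `ℤ_p`-extension, for EVERY prime `p`** (dividing the
level `N` or not): for `W/ℚ` elliptic, `K` imaginary quadratic, every parametrisation datum `Dt` at
level `N`, orientation `β` (`4N ∣ β² − d_K`), embedding `jbar : K̄ → ℂ` and `ℤ_p`-extension `κ` there
is a Heegner family `F : HeegnerFamily N W K κ jbar` with `F.Dt = Dt` and `F.β = β` — `y` of conductor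
`1` over `K`, `z j = Norm_{K_j K[p^{j+1}]/K_j} P[p^{j+1}]` of conductor `p^{j+1}` over `K_j`
(`exists_isHeegnerNormPoint_of_ne_zero` at `c = 1` and `c = p^{j+1} ≠ 0`). The twin of
`exists_heegnerFamily_Dt_eq_holds` without `¬ p ∣ N` (and without the Heegner hypothesis, which only
the ARITHMETIC of the family — trace relations, non-triviality — needs, not its existence).
[cite: Howard2004HeegnerKolyvagin, §3.3 (before Thm. 3.3.7)] [cite: GrossLMS1991, §3 (p. 238)] -/
theorem exists_heegnerFamily_Dt_eq_of_dvd_sq_sub [W.IsElliptic] (hK : IsImaginaryQuadratic K)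
    (κ : ZpExtension K p) (Dt : ModularParametrizationData W N) {β : ℤ}
    (hβ : (4 * N : ℤ) ∣ β ^ 2 - NumberField.discr K) (jbar : AlgebraicClosure K →+* ℂ) :
    ∃ F : HeegnerFamily N W K κ jbar, F.Dt = Dt ∧ F.β = β := by
  have hc : ∀ j : ℕ, p ^ (j + 1) ≠ 0 := fun j ↦ pow_ne_zero _ (Fact.out : p.Prime).ne_zero
  choose z hz using fun j : ℕ ↦ exists_isHeegnerNormPoint_of_ne_zero N W K hK κ Dt hβ jbar j (hc j)
  obtain ⟨y, hy⟩ := exists_isHeegnerNormPoint_of_ne_zero N W K hK κ Dt hβ jbar 0 one_ne_zero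
  exact ⟨⟨Dt, β, hβ, y, hy, z, hz⟩, rfl, rfl⟩

/-- **Heegner families exist along every `ℤ_p`-extension, for every prime `p`** (`Nonempty` form of
`exists_heegnerFamily_Dt_eq_of_dvd_sq_sub`; the twin of `nonempty_heegnerFamily_of` without `p ∤ N`).
[cite: Howard2004HeegnerKolyvagin, §3.3 (before Thm. 3.3.7)] -/
theorem nonempty_heegnerFamily_of_dvd_sq_sub [W.IsElliptic] (hK : IsImaginaryQuadratic K)
    (κ : ZpExtension K p) (Dt : ModularParametrizationData W N) {β : ℤ}
    (hβ : (4 * N : ℤ) ∣ β ^ 2 - NumberField.discr K) (jbar : AlgebraicClosure K →+* ℂ) :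
    Nonempty (HeegnerFamily N W K κ jbar) := by
  obtain ⟨F, -, -⟩ := exists_heegnerFamily_Dt_eq_of_dvd_sq_sub hK κ Dt hβ jbar
  exact ⟨F⟩

/-- **The canonical Heegner family, with its CM points exposed**: for every prime `p`, datum `Dt`,
orientation `β`, `jbar` and `ℤ_p`-extension `κ` there is `F : HeegnerFamily N W K κ jbar` with
`F.Dt = Dt`, `F.β = β`, whose bottom point is the norm to `K` of a `K[1]`-rational point `x` with
`complexPoint x = y(1)` and whose every `z j` is `∑_{r ∈ R_j} r • x_j` for a `K[p^{j+1}]`-rational point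
`x_j ∈ E(K̄)` with `complexPoint x_j = y(p^{j+1}) = φ(x(p^{j+1}))` (the canonical Heegner point of
conductor `p^{j+1}`: root of `(p^{2j+2}(β² − d_K)/4, p^{j+1}β, 1)`) and `R_j ⊆ Gal(K̄/K_j)` a transversal
of `Gal(K̄/K_j K[p^{j+1}])`. This is the family print works with (Gross 1991 §3, `y_n = φ(x_n)`; Howard
2004 §2.7, `P[p^{k+1}]`; at `p ∣ N` these points are GOOD CM points in the sense of Cornut–Vatsal 2007
Def. 1.6, see the module docstring). [cite: GrossLMS1991, §3 (p. 238)]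
[cite: Howard2004HeegnerKolyvagin, §2.7 and §3.3] -/
theorem exists_heegnerFamily_canonical [W.IsElliptic] (hK : IsImaginaryQuadratic K)
    (κ : ZpExtension K p) (Dt : ModularParametrizationData W N) {β : ℤ}
    (hβ : (4 * N : ℤ) ∣ β ^ 2 - NumberField.discr K) (jbar : AlgebraicClosure K →+* ℂ) :
    ∃ F : HeegnerFamily N W K κ jbar, F.Dt = Dt ∧ F.β = β ∧
      (∃ (x : geomPoints (W.baseChange K)) (R : Finset (Field.absoluteGaloisGroup K)),
        complexPoint W jbar x = heegnerPointComplexOfConductor Dt (NumberField.discr K) β 1 ∧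
        (∀ σ ∈ ringClassSubgroup K 1 jbar, σ • x = x) ∧
        (∀ τ : Field.absoluteGaloisGroup K, ∃! r, r ∈ R ∧ r⁻¹ * τ ∈ ringClassSubgroup K 1 jbar) ∧
        F.y = ∑ r ∈ R, r • x) ∧
      ∀ j : ℕ, ∃ (x : geomPoints (W.baseChange K)) (R : Finset (Field.absoluteGaloisGroup K)),
        complexPoint W jbar x =
          heegnerPointComplexOfConductor Dt (NumberField.discr K) β (p ^ (j + 1)) ∧
        (∀ σ ∈ ringClassSubgroup K (p ^ (j + 1)) jbar, σ • x = x) ∧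
        (↑R ⊆ (κ.layerSubgroup j : Set (Field.absoluteGaloisGroup K))) ∧
        (∀ τ ∈ κ.layerSubgroup j, ∃! r, r ∈ R ∧ r⁻¹ * τ ∈ ringClassSubgroup K (p ^ (j + 1)) jbar) ∧
        F.z j = ∑ r ∈ R, r • x := by
  have hc : ∀ j : ℕ, p ^ (j + 1) ≠ 0 := fun j ↦ pow_ne_zero _ (Fact.out : p.Prime).ne_zero
  choose x R hx _hg hfix hRsub htrans hz using
    fun j : ℕ ↦ exists_canonical_isHeegnerNormPoint_of_ne_zero N W K hK κ Dt hβ jbar j (hc j)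
  obtain ⟨x₀, R₀, hx₀, -, hfix₀, hR₀sub, htrans₀, hy⟩ :=
    exists_canonical_isHeegnerNormPoint_of_ne_zero N W K hK κ Dt hβ jbar 0 one_ne_zero
  refine ⟨⟨Dt, β, hβ, ∑ r ∈ R₀, r • x₀, hy, fun j ↦ ∑ r ∈ R j, r • x j, hz⟩, rfl, rfl,
    ⟨x₀, R₀, hx₀, hfix₀, fun τ ↦ htrans₀ τ ?_, rfl⟩, fun j ↦ ⟨x j, R j, hx j, hfix j, hRsub j, htrans j, rfl⟩⟩
  rw [ZpExtension.layerSubgroup_zero]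
  trivial

end Literature.NumberTheory.EllipticCurves

end
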